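import Literature.AlgebraicGeometry.HodgeTheory.SecantQuotientJacobianTwistedCarrier

/-!
# `SemiregularSheafRepresentativesTwAtDiag` (stmt-HodgeConjecture-19787) · Negative · the Markman `[claim]` schema is load-bearing in `Adm`

`Literature.AlgebraicGeometry.HodgeTheory.Markman2025_secantQuotient_twistedCarrier_onJacobian C Adm` and its pinned
form are hypothesis SCHEMATA in `(C, Adm)`.  At the EMPTY admissibility notion `Adm := fun _ _ _ _ => False` both are
FALSE (the datum clause, instantiated on the identity chart `e := Iso.refl`, asks for an `Adm`-admissible complex):
so the claim is not a tautology of its shape, and any consumer `(hM : … C Adm)` genuinely assumes something about `Adm`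
(print supports it only for notions satisfied by a finite locally free resolution of Markman's semiregular reflexive
sheaf `σ̄^*𝓔̄`, e.g. full Buchweitz–Flenner semiregularity with `Ext^{<0} = 0`; it is NOT supported by print for
notions demanding a vector bundle in degree `0`, `𝓔̄` being reflexive but not locally free, Prop. 9.2.2).  In particular the
road's consumers `(hM : … C AdmTw)` (`…SecantQuotientAnchorMarkman`, `…AnchorPinnedMarkman`) carry a genuine, claim-tagged
assumption.  Refuter seat refuter-pub-hodge-ring2-refute-markman-g0-0 (hostile read of p507959 / p510628, REFUTE-MARKMAN.md),
2026-08-27.  [cite: Markman2025SecantWeil, §1.5 (p. 7) and Prop. 9.2.2]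
-/

open CategoryTheory
open Literature.AlgebraicTopology.SingularHomology
open Literature.AlgebraicGeometry.Motives Literature.AlgebraicGeometry.Markman2025

namespace Summit.HodgeConjecture.HodgeConjecture.Theorems.SemiregularSheafRepresentativesTwAtDiag.Negative.MarkmanTwistedCarrierFalseAtAdmBot

open Literature.AlgebraicGeometry.HodgeTheory

/-- At the empty admissibility notion the secant quotient carries NO twisted carrier of Weil shape: the datum clause on
the identity chart has no witness. [cite: Markman2025SecantWeil, §1.5 (p. 7)] -/
theorem not_hasTwistedCarrierOnSecantQuotient_of_adm_bot (C : ChernCharacterBetti)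
    (A : AbelianVariety ℂ) {Θ : CartierDivisor A.X.left} (hΘ : Θ.IsAmple) (hK : A.KTheta Θ = ⊥)
    (G₁ G₂ : Subgroup (A.Points ℂ)) {n : ℕ} (hn : n ≠ 0) (h₁ : G₁ ≤ A.torsionPoints ℂ n)
    (h₂ : G₂ ≤ A.torsionPoints ℂ n) (d : ℕ) :
    ¬ HasTwistedCarrierOnSecantQuotient C (fun _ _ _ _ => False) A hΘ hK G₁ G₂ hn h₁ h₂ d := by
  rintro ⟨θ, γ, -, -, -, -, -, -, hcopy⟩
  obtain ⟨I, κ, c, -, ⟨E, hE, B₀, hAdm, -⟩, -⟩ := hcopy _ (Iso.refl _)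
  exact hAdm

/-- The same for GIVEN classes `(θ, γ)`. [cite: Markman2025SecantWeil, §1.5 (p. 7)] -/
theorem not_isTwistedCarrierWeilPairOn_of_adm_bot (C : ChernCharacterBetti)
    (A : AbelianVariety ℂ) {Θ : CartierDivisor A.X.left} (hΘ : Θ.IsAmple) (hK : A.KTheta Θ = ⊥)
    (G₁ G₂ : Subgroup (A.Points ℂ)) {n : ℕ} (hn : n ≠ 0) (h₁ : G₁ ≤ A.torsionPoints ℂ n)
    (h₂ : G₂ ≤ A.torsionPoints ℂ n) (d : ℕ) (θ : complexBetti (secantQuotient A hΘ G₁ G₂ hn h₁ h₂).X 2)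
    (γ : complexBetti (secantQuotient A hΘ G₁ G₂ hn h₁ h₂).X (2 * 3)) :
    ¬ IsTwistedCarrierWeilPairOn C (fun _ _ _ _ => False) A hΘ hK G₁ G₂ hn h₁ h₂ d θ γ := by
  rintro ⟨-, -, -, -, -, -, hcopy⟩
  obtain ⟨I, κ, c, -, ⟨E, hE, B₀, hAdm, -⟩, -⟩ := hcopy _ (Iso.refl _)
  exact hAdm

/-- **`Markman2025_secantQuotient_twistedCarrier_onJacobian C ⊥` is FALSE**: specialise `d := 4` and apply the chart lemma.
[cite: Markman2025SecantWeil, §1.5 (p. 7)] -/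
theorem not_markman2025_secantQuotient_twistedCarrier_onJacobian_of_adm_bot (C : ChernCharacterBetti) :
    ¬ Markman2025_secantQuotient_twistedCarrier_onJacobian C (fun _ _ _ _ => False) := by
  intro h
  obtain ⟨Cᵥ, _, 𝒥, _, Θ, _, hP, G₁, G₂, h₁, h₂, -, -, -, -, -, -, hcar⟩ := h 4 ⟨2, rfl⟩ le_rfl
  exact not_hasTwistedCarrierOnSecantQuotient_of_adm_bot C 𝒥.J hP.isAmple hP.KTheta_eq_bot G₁ G₂
    (Nat.succ_ne_zero 4) h₁ h₂ 4 hcar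

/-- **`Markman2025_secantQuotient_twistedCarrier_onJacobian_pinned C ⊥` is FALSE.** [cite: Markman2025SecantWeil, §1.5 (p. 7)] -/
theorem not_markman2025_secantQuotient_twistedCarrier_onJacobian_pinned_of_adm_bot (C : ChernCharacterBetti) :
    ¬ Markman2025_secantQuotient_twistedCarrier_onJacobian_pinned C (fun _ _ _ _ => False) := by
  intro h
  obtain ⟨Cᵥ, _, 𝒥, _, Θ, _, hP, G₁, G₂, h₁, h₂, -, -, -, -, -, -, θ₀, γ, -, hpair⟩ := h 4 ⟨2, rfl⟩ le_rfl
  exact not_isTwistedCarrierWeilPairOn_of_adm_bot C 𝒥.J hP.isAmple hP.KTheta_eq_bot G₁ G₂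
    (Nat.succ_ne_zero 4) h₁ h₂ 4 _ γ hpair

end Summit.HodgeConjecture.HodgeConjecture.Theorems.SemiregularSheafRepresentativesTwAtDiag.Negative.MarkmanTwistedCarrierFalseAtAdmBot
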